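import Summits.AnomalousDissipation.AnomalousDissipation.Theorems.GenericRunawayStokesScaling.Negative.Helicity

/-!
# Negative knowledge for the crux `MirrorVariety.GenericRunawayStokesScaling` (stmt-AnomalousDissipation-2990), VIII:
# cone points are never nondegenerate — `Range DQ(U) ⊥ U` and `⊥ curl U`

Certified copy of §12 of the cdisprove work file.  `trilinear_antisymm`: finite Fourier proof of the antisymmetry of
the truncated trilinear form, `∑_k Re⟪B(a,b)_k, c_k⟫ = -∑_k Re⟪B(a,c)_k, b_k⟫` for `a` transversal (after conjugate
symmetry the paired sum is `∑_{l+m+k=0}(a_l·(m̂+k̂))(b_m·c_k) = -∑ (a_l·l̂)(…) = 0`); `sum_re_inner_projB_self`: the energy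
identity of the truncation; at a truncated-Euler state `Q_S(U,U) = 0`: `sum_re_inner_symB_self` (`⟨L_U v, U⟩ = 0`),
`sum_re_inner_symB_curl` (`⟨L_U v, curl U⟩ = 0`, polarising the helicity identity of part VI, `helForm_polarise`),
`symB_self_eq_zero` (`U ∈ ker L_U`).  Hence `L_U = DQ(U)` has corank ≥ 2 on the Galerkin space whenever `curl U ∦ U`
(and its kernel contains the same-helicity shell at Beltrami points): the hypothesis `ker L_U = ℝU` of an IFT
construction of runaway ends is never met; the Lyapunov–Schmidt reduction at infinity has a kernel of dimension ≥ 2.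
Supports stmt-AnomalousDissipation-2990.
-/

set_option linter.dupNamespace false

noncomputable section

open scoped BigOperators InnerProductSpace ComplexConjugate
open Filter Set Function

namespace Summit.AnomalousDissipation.AnomalousDissipation.Theorems.GenericRunawayStokesScaling.Negative

open Literature.Analysis.FunctionSpaces Literature.Analysis.FunctionSpaces.Torus
open Literature.Analysis.FluidPDE Literature.Analysis.FluidPDE.Torus
open Summit.AnomalousDissipation.AnomalousDissipation.Theses.MirrorVariety

/-! ## §12 Cone points are never nondegenerate: `Range DQ(U) ⊥ U` and `⊥ curl U`

Finite Fourier proof of the antisymmetry of the trilinear form, `b(a,b,c) = -b(a,c,b)` for transversal `a`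
(`∫ a·∇(b·c) = 0`: after conjugate symmetry the paired sum is `∑_{l+m+n=0} (a_l·(m+n))(b_m·c_n) = -∑ (a_l·l)(…) = 0`),
whence the ENERGY identity `b(c,c,c) = 0` again, and at a truncated-Euler state `Q(U) = 0`:
`⟨L_U v, U⟩ = 0` for all `v` (`sum_re_inner_symB_self`), and — polarising the helicity identity of §10 —
`⟨L_U v, curl U⟩ = 0` (`sum_re_inner_symB_curl`).  So `Range L_U ⊥ U, curl U` and, `U` being in `ker L_U`,
the linearisation `L_U = DQ(U)` on the Galerkin space has corank ≥ 2 (kernel of dimension ≥ 2) whenever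
`curl U ∦ U`, and at Beltrami points the kernel contains the whole same-helicity shell: NO cone direction is
nondegenerate — the dimension count is recorded here, the two orthogonality laws are the theorems. -/

section Cone

variable {S : Finset (Fin 3 → ℤ)}

/-- **Quantitative frustration criterion** (energy identity + `|k|² ≤ N²`): at every point of `V_N(g)`,
`|∑_k Re⟪ĝ_k, c_k⟫| ≤ 4π² N² |ν| ∑_k ‖c_k‖²`.  So along a runaway `‖c‖ → ∞` the Stokes rate `|ν|‖c‖ ≥ c₀^{1/2}`
holds as soon as the normalised injection `⟨g, c/‖c‖₂⟩` stays bounded away from `0`: the crux is EXACTLY the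
statement that no runaway of a regular variety escapes along directions asymptotically `L²`-orthogonal to the
force (cf. `force_orthogonal_on_zero_fibre`). [folklore] -/
theorem abs_injection_le {N : ℕ} {g : ↥(PB N) → (EuclideanSpace ℂ (Fin 3))} (hg : g ∈ galerkinSubspace (PB N))
    {z : (↥(PB N) → (EuclideanSpace ℂ (Fin 3))) × ℝ} (hz : z ∈ variety (PB N) g) :
    |∑ k : ↥(PB N), (inner ℂ (g k) (z.1 k)).re| ≤
      4 * Real.pi ^ 2 * (N : ℝ) ^ 2 * |z.2| * ∑ k : ↥(PB N), ‖z.1 k‖ ^ 2 := by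
  have hE := energy_identity (PB_symm N) hg.1 hz
  have hP : 0 ≤ 4 * Real.pi ^ 2 * ∑ k : ↥(PB N), freqNormSq (k : Fin 3 → ℤ) * ‖z.1 k‖ ^ 2 := by
    have := Finset.sum_nonneg fun k (_ : k ∈ (Finset.univ : Finset ↥(PB N))) =>
      mul_nonneg (freqNormSq_nonneg (k : Fin 3 → ℤ)) (sq_nonneg ‖z.1 k‖)
    positivity
  have hk : ∀ k : ↥(PB N), freqNormSq (k : Fin 3 → ℤ) * ‖z.1 k‖ ^ 2 ≤ (N : ℝ) ^ 2 * ‖z.1 k‖ ^ 2 := by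
    intro k
    have h := (mem_PB_iff.1 k.2).2
    have h' : freqNormSq (k : Fin 3 → ℤ) ≤ (N : ℝ) ^ 2 := by
      rw [freqNormSq_eq_intCast]; exact_mod_cast h
    exact mul_le_mul_of_nonneg_right h' (sq_nonneg _)
  have hsum : ∑ k : ↥(PB N), freqNormSq (k : Fin 3 → ℤ) * ‖z.1 k‖ ^ 2 ≤ (N : ℝ) ^ 2 * ∑ k : ↥(PB N), ‖z.1 k‖ ^ 2 := by
    rw [Finset.mul_sum]; exact Finset.sum_le_sum fun k _ => hk k
  calc |∑ k : ↥(PB N), (inner ℂ (g k) (z.1 k)).re|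
      = |z.2| * (4 * Real.pi ^ 2 * ∑ k : ↥(PB N), freqNormSq (k : Fin 3 → ℤ) * ‖z.1 k‖ ^ 2) := by
        rw [← hE, abs_mul, abs_of_nonneg hP]
    _ ≤ |z.2| * (4 * Real.pi ^ 2 * ((N : ℝ) ^ 2 * ∑ k : ↥(PB N), ‖z.1 k‖ ^ 2)) := by gcongr
    _ = 4 * Real.pi ^ 2 * (N : ℝ) ^ 2 * |z.2| * ∑ k : ↥(PB N), ‖z.1 k‖ ^ 2 := by ring

/-- Antisymmetry of the triple product in its last two slots: `(a×b)·c = -((a×c)·b)`. [folklore] -/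
theorem bdot_crossC_antisymm_right (a b c : (EuclideanSpace ℂ (Fin 3))) : bdot (crossC a b) c = -bdot (crossC a c) b := by
  simp only [bdot_eq, crossC_apply_zero, crossC_apply_one, crossC_apply_two]; ring

/-- The paired trilinear summand `P(l,m,k) = Re[(a₋ₗ·m̂)(b₋ₘ · c_k)]`… in bilinear form after conjugation:
`Re⟪(a_l·m) b_m, c_k⟫ = Re[(a₋ₗ · m̂)(b₋ₘ · c_k)]` (conjugate symmetry; `conj m̂ = m̂`). [folklore] -/
theorem re_inner_convTerm {a b : (Fin 3 → ℤ) → (EuclideanSpace ℂ (Fin 3))} (ha : IsConjSymm a) (hb : IsConjSymm b) (l m : Fin 3 → ℤ)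
    (x : (EuclideanSpace ℂ (Fin 3))) :
    (inner ℂ ((2 * Real.pi * Complex.I * bdot (a l) (freqVec m)) • b m) x).re =
      -(2 * Real.pi * (Complex.I * (bdot (a (-l)) (freqVec m) * bdot (b (-m)) x))).re := by
  rw [inner_smul_left, inner_eq_bdot_conjVec, ← hb m]
  have hconj : starRingEnd ℂ (bdot (a l) (freqVec m)) = bdot (a (-l)) (freqVec m) := by
    rw [ha l]
    simp [bdot, Fin.sum_univ_three, EuclideanSpace.conjVec_apply, freqVec_apply]
  simp only [map_mul, map_ofNat, Complex.conj_ofReal, Complex.conj_I, hconj]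
  rw [← Complex.neg_re]
  congr 1
  ring

/-- **The trilinear form in triple-sum shape**: for conjugate-symmetric families,
`∑_{k∈S} Re⟪B(a,b)_k, c_k⟫ = -2π ∑_{k,l,m∈S, l+m+k=0} Re[i (a_l·freqVec(-m)) (b_m · c_k)]`. [folklore] -/
theorem sum_re_inner_convectionCoeff_eq_triple (hS : ∀ k ∈ S, -k ∈ S) {a b : (Fin 3 → ℤ) → (EuclideanSpace ℂ (Fin 3))}
    (ha : IsConjSymm a) (hb : IsConjSymm b) (c : (Fin 3 → ℤ) → (EuclideanSpace ℂ (Fin 3))) :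
    ∑ k ∈ S, (inner ℂ (convectionCoeff S a b k) (c k)).re =
      ∑ k ∈ S, ∑ l ∈ S, ∑ m ∈ S, if l + m + k = 0 then
        -(2 * Real.pi * (Complex.I * (bdot (a l) (freqVec (-m)) * bdot (b m) (c k)))).re else 0 := by
  refine Finset.sum_congr rfl fun k _ => ?_
  rw [convectionCoeff_eq_bdot, sum_inner, Complex.re_sum, sum_neg_index hS]
  refine Finset.sum_congr rfl fun l _ => ?_
  rw [sum_inner, Complex.re_sum, sum_neg_index hS]
  refine Finset.sum_congr rfl fun m _ => ?_
  rw [if_congr (neg_add_neg_eq_iff l m k) rfl rfl]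
  split_ifs with h
  · rw [re_inner_convTerm ha hb, neg_neg, neg_neg]
  · simp

/-- `m̂ + k̂ = -l̂` under the triad condition, against a transversal `a_l`: `a_l·freqVec(-m) + a_l·freqVec(-k) = 0`
whenever `l + m + k = 0` and `a_l · l = 0`. [folklore] -/
theorem bdot_freqVec_neg_add {a : (Fin 3 → ℤ) → (EuclideanSpace ℂ (Fin 3))} {l m k : Fin 3 → ℤ} (h : l + m + k = 0)
    (hal : ∑ j, (l j : ℂ) * a l j = 0) : bdot (a l) (freqVec (-m)) + bdot (a l) (freqVec (-k)) = 0 := by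
  have hk : k = -(l + m) := (neg_eq_of_add_eq_zero_right h).symm
  subst hk
  simp only [bdot, freqVec_apply, Pi.neg_apply, Pi.add_apply, neg_add, neg_neg, Int.cast_neg, Int.cast_add,
    ← Finset.sum_add_distrib]
  calc ∑ j, (a l j * -(m j : ℂ) + a l j * ((l j : ℂ) + (m j : ℂ))) = ∑ j, (l j : ℂ) * a l j :=
        Finset.sum_congr rfl fun j _ => by ring
    _ = 0 := hal

/-- **Antisymmetry of the truncated trilinear form** `b(a,b,c) = -b(a,c,b)` for `a` transversal on `S`
(all three conjugate symmetric): `∑_k Re⟪B(a,b)_k, c_k⟫ = -∑_k Re⟪B(a,c)_k, b_k⟫`. [folklore] -/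
theorem trilinear_antisymm (hS : ∀ k ∈ S, -k ∈ S) {a b c : (Fin 3 → ℤ) → (EuclideanSpace ℂ (Fin 3))} (ha : IsConjSymm a)
    (hb : IsConjSymm b) (hc : IsConjSymm c) (haT : IsTransversal S a) :
    ∑ k ∈ S, (inner ℂ (convectionCoeff S a b k) (c k)).re = -∑ k ∈ S, (inner ℂ (convectionCoeff S a c k) (b k)).re := by
  rw [sum_re_inner_convectionCoeff_eq_triple hS ha hb c, sum_re_inner_convectionCoeff_eq_triple hS ha hc b]
  -- exchange `m ↔ k` in the second triple sum and add
  rw [← sub_eq_zero, sub_neg_eq_add]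
  have hswap : ∑ k ∈ S, ∑ l ∈ S, ∑ m ∈ S, (if l + m + k = 0 then
      -(2 * Real.pi * (Complex.I * (bdot (a l) (freqVec (-m)) * bdot (c m) (b k)))).re else 0) =
      ∑ k ∈ S, ∑ l ∈ S, ∑ m ∈ S, (if l + m + k = 0 then
      -(2 * Real.pi * (Complex.I * (bdot (a l) (freqVec (-k)) * bdot (c k) (b m)))).re else 0) := by
    calc (∑ k ∈ S, ∑ l ∈ S, ∑ m ∈ S, (if l + m + k = 0 then
          -(2 * Real.pi * (Complex.I * (bdot (a l) (freqVec (-m)) * bdot (c m) (b k)))).re else 0))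
        = ∑ l ∈ S, ∑ k ∈ S, ∑ m ∈ S, (if l + m + k = 0 then
          -(2 * Real.pi * (Complex.I * (bdot (a l) (freqVec (-m)) * bdot (c m) (b k)))).re else 0) :=
          Finset.sum_comm
      _ = ∑ l ∈ S, ∑ m ∈ S, ∑ k ∈ S, (if l + m + k = 0 then
          -(2 * Real.pi * (Complex.I * (bdot (a l) (freqVec (-m)) * bdot (c m) (b k)))).re else 0) :=
          Finset.sum_congr rfl fun l _ => Finset.sum_comm
      _ = ∑ l ∈ S, ∑ k ∈ S, ∑ m ∈ S, (if l + m + k = 0 then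
          -(2 * Real.pi * (Complex.I * (bdot (a l) (freqVec (-k)) * bdot (c k) (b m)))).re else 0) := by
          refine Finset.sum_congr rfl fun l _ => Finset.sum_congr rfl fun x _ => Finset.sum_congr rfl fun y _ => ?_
          exact if_congr ⟨fun h => by rw [← h]; abel, fun h => by rw [← h]; abel⟩ rfl rfl
      _ = _ := Finset.sum_comm
  rw [hswap, ← Finset.sum_add_distrib]
  refine Finset.sum_eq_zero fun k _ => ?_
  rw [← Finset.sum_add_distrib]
  refine Finset.sum_eq_zero fun l hl => ?_
  rw [← Finset.sum_add_distrib]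
  refine Finset.sum_eq_zero fun m _ => ?_
  split_ifs with h
  · have hsum := bdot_freqVec_neg_add (a := a) h (haT l hl)
    have : bdot (c k) (b m) = bdot (b m) (c k) := by simp only [bdot_eq]; ring
    rw [this, ← Complex.neg_re, ← Complex.neg_re, ← Complex.add_re, ← neg_add, ← mul_add, ← mul_add,
      ← add_mul, hsum]
    simp
  · simp

/-- **Energy identity of the truncation, finite proof**: `∑_k Re⟪Q_S(c,c)_k, c_k⟫ = 0`. [folklore] -/
theorem sum_re_inner_projB_self (hS : ∀ k ∈ S, -k ∈ S) {c : ↥S → (EuclideanSpace ℂ (Fin 3))} (hc : c ∈ galerkinSubspace S) :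
    ∑ k : ↥S, (inner ℂ (projB S c c k) (c k)).re = 0 := by
  have hC : IsConjSymm (coeffExt S c) := hc.1.isConjSymm_coeffExt hS
  have h1 : ∀ k : ↥S, (inner ℂ (projB S c c k) (c k)).re =
      (inner ℂ (convectionCoeff S (coeffExt S c) (coeffExt S c) k) (coeffExt S c k)).re := by
    intro k; rw [projB, inner_leraySym_left_of_transversal _ _ (hc.2 k), coeffExt_coe]
  simp only [h1]
  rw [Finset.sum_coe_sort S (fun k => (inner ℂ (convectionCoeff S (coeffExt S c) (coeffExt S c) k) (coeffExt S c k)).re)]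
  have h := trilinear_antisymm hS hC hC hC hc.2.isTransversal_coeffExt
  linarith

/-- **At a cone point the linearisation is orthogonal to the state**: if `Q_S(U,U) = 0` then
`∑_k Re⟪L_U v_k, U_k⟫ = 0` for every `v` in the Galerkin space. [folklore] -/
theorem sum_re_inner_symB_self (hS : ∀ k ∈ S, -k ∈ S) {U v : ↥S → (EuclideanSpace ℂ (Fin 3))} (hU : U ∈ galerkinSubspace S)
    (hv : v ∈ galerkinSubspace S) (hcone : projB S U U = 0) :
    ∑ k : ↥S, (inner ℂ (symB S U v k) (U k)).re = 0 := by
  have hUc : IsConjSymm (coeffExt S U) := hU.1.isConjSymm_coeffExt hS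
  have hvc : IsConjSymm (coeffExt S v) := hv.1.isConjSymm_coeffExt hS
  -- `⟨B(U,v), U⟩ = -⟨B(U,U), v⟩ = -⟨Q(U,U), v⟩ = 0` and `⟨B(v,U), U⟩ = -⟨B(v,U), U⟩ = 0`
  have h1 : ∀ k : ↥S, (inner ℂ (symB S U v k) (U k)).re =
      (inner ℂ (convectionCoeff S (coeffExt S U) (coeffExt S v) k) (coeffExt S U k)).re +
        (inner ℂ (convectionCoeff S (coeffExt S v) (coeffExt S U) k) (coeffExt S U k)).re := by
    intro k
    rw [symB, Pi.add_apply, inner_add_left, Complex.add_re, projB, projB,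
      inner_leraySym_left_of_transversal _ _ (hU.2 k), inner_leraySym_left_of_transversal _ _ (hU.2 k),
      coeffExt_coe]
  simp only [h1, Finset.sum_add_distrib]
  rw [Finset.sum_coe_sort S (fun k => (inner ℂ (convectionCoeff S (coeffExt S U) (coeffExt S v) k) (coeffExt S U k)).re),
    Finset.sum_coe_sort S (fun k => (inner ℂ (convectionCoeff S (coeffExt S v) (coeffExt S U) k) (coeffExt S U k)).re)]
  have hA := trilinear_antisymm hS hUc hvc hUc hU.2.isTransversal_coeffExt
  have hB := trilinear_antisymm hS hvc hUc hUc hv.2.isTransversal_coeffExt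
  -- `⟨B(U,U), v⟩ = ⟨Q(U,U), v⟩ = 0` since `v` is transversal and `Q(U,U) = 0`
  have hQ : ∑ k ∈ S, (inner ℂ (convectionCoeff S (coeffExt S U) (coeffExt S U) k) (coeffExt S v k)).re = 0 := by
    rw [← Finset.sum_coe_sort]
    refine Finset.sum_eq_zero fun k _ => ?_
    have := congrFun hcone k
    rw [projB, Pi.zero_apply] at this
    rw [coeffExt_coe, ← inner_leraySym_left_of_transversal _ _ (hv.2 k), this, inner_zero_left, Complex.zero_re]
  linarith

/-- A trilinear shape for the polarisation of the helicity identity. [folklore] -/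
def helForm (S : Finset (Fin 3 → ℤ)) (a b d : ↥S → (EuclideanSpace ℂ (Fin 3))) : ℝ :=
  ∑ k : ↥S, (inner ℂ (projB S a b k) (curlVec (k : Fin 3 → ℤ) (d k))).re

/-- `curlVec` is additive. [folklore] -/
theorem curlVec_add (k : Fin 3 → ℤ) (v w : (EuclideanSpace ℂ (Fin 3))) : curlVec k (v + w) = curlVec k v + curlVec k w := by
  ext i; fin_cases i <;> simp [curlVec] <;> ring

/-- `curlVec` commutes with real scalars. [folklore] -/
theorem curlVec_real_smul (k : Fin 3 → ℤ) (a : ℝ) (v : (EuclideanSpace ℂ (Fin 3))) : curlVec k (a • v) = a • curlVec k v := by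
  ext i; fin_cases i <;> simp [curlVec] <;> ring

/-- `helForm` is additive in each slot. [folklore] -/
theorem helForm_add_left (a a' b d : ↥S → (EuclideanSpace ℂ (Fin 3))) : helForm S (a + a') b d = helForm S a b d + helForm S a' b d := by
  simp only [helForm, projB_add_left, Pi.add_apply, inner_add_left, Complex.add_re, Finset.sum_add_distrib]
/-- `helForm` is additive in each slot. [folklore] -/
theorem helForm_add_mid (a b b' d : ↥S → (EuclideanSpace ℂ (Fin 3))) : helForm S a (b + b') d = helForm S a b d + helForm S a b' d := by
  simp only [helForm, projB_add_right, Pi.add_apply, inner_add_left, Complex.add_re, Finset.sum_add_distrib]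
/-- `helForm` is additive in each slot. [folklore] -/
theorem helForm_add_right (a b d d' : ↥S → (EuclideanSpace ℂ (Fin 3))) : helForm S a b (d + d') = helForm S a b d + helForm S a b d' := by
  simp only [helForm, Pi.add_apply, curlVec_add, inner_add_right, Complex.add_re, Finset.sum_add_distrib]
/-- `helForm` is odd in each slot. [folklore] -/
theorem helForm_neg_left (a b d : ↥S → (EuclideanSpace ℂ (Fin 3))) : helForm S (-a) b d = -helForm S a b d := by
  have h := helForm_add_left a (-a) b d
  rw [add_neg_cancel] at h
  have h0 : helForm S 0 b d = 0 := by simp [helForm, projB_zero_left]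
  linarith
/-- `helForm` is odd in each slot. [folklore] -/
theorem helForm_neg_mid (a b d : ↥S → (EuclideanSpace ℂ (Fin 3))) : helForm S a (-b) d = -helForm S a b d := by
  have h := helForm_add_mid a b (-b) d
  rw [add_neg_cancel] at h
  have h0 : helForm S a 0 d = 0 := by simp [helForm, projB_zero_right]
  linarith
/-- `helForm` is odd in each slot. [folklore] -/
theorem helForm_neg_right (a b d : ↥S → (EuclideanSpace ℂ (Fin 3))) : helForm S a b (-d) = -helForm S a b d := by
  have h := helForm_add_right a b d (-d)
  rw [add_neg_cancel] at h
  have h0 : helForm S a b 0 = 0 := by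
    simp only [helForm, Pi.zero_apply]
    refine Finset.sum_eq_zero fun k _ => ?_
    have : curlVec (k : Fin 3 → ℤ) (0 : (EuclideanSpace ℂ (Fin 3))) = 0 := by ext i; fin_cases i <;> simp [curlVec]
    rw [this, inner_zero_right, Complex.zero_re]
  linarith

/-- **Polarisation of a cubic form**: `Φ(U+v,U+v,U+v) - Φ(U-v,U-v,U-v) = 2(Φ(v,U,U)+Φ(U,v,U)+Φ(U,U,v)) + 2Φ(v,v,v)`. [folklore] -/
theorem helForm_polarise (U v : ↥S → (EuclideanSpace ℂ (Fin 3))) :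
    helForm S (U + v) (U + v) (U + v) - helForm S (U - v) (U - v) (U - v) =
      2 * (helForm S v U U + helForm S U v U + helForm S U U v) + 2 * helForm S v v v := by
  simp only [sub_eq_add_neg, helForm_add_left, helForm_add_mid, helForm_add_right, helForm_neg_left,
    helForm_neg_mid, helForm_neg_right]
  ring

/-- **At a cone point the linearisation is orthogonal to the vorticity**: if `Q_S(U,U) = 0` then
`∑_k Re⟪L_U v_k, 2πi k × U_k⟫ = 0` for every `v` in the Galerkin space (derivative of the helicity identity). [folklore] -/
theorem sum_re_inner_symB_curl (hS : ∀ k ∈ S, -k ∈ S) {U v : ↥S → (EuclideanSpace ℂ (Fin 3))} (hU : U ∈ galerkinSubspace S)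
    (hv : v ∈ galerkinSubspace S) (hcone : projB S U U = 0) :
    ∑ k : ↥S, (inner ℂ (symB S U v k) (curlVec (k : Fin 3 → ℤ) (U k))).re = 0 := by
  have hH := helicityIdentity_holds hS
  have h1 : helForm S (U + v) (U + v) (U + v) = 0 := hH _ (Submodule.add_mem _ hU hv)
  have h2 : helForm S (U - v) (U - v) (U - v) = 0 := hH _ (Submodule.sub_mem _ hU hv)
  have h3 : helForm S v v v = 0 := hH _ hv
  have h4 : helForm S U U v = 0 := by
    simp only [helForm, hcone, Pi.zero_apply, inner_zero_left, Complex.zero_re, Finset.sum_const_zero]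
  have hpol := helForm_polarise (S := S) U v
  rw [h1, h2, h3, h4] at hpol
  have h5 : helForm S v U U + helForm S U v U = 0 := by linarith
  -- `⟨L_U v, curl U⟩ = Φ(U,v,U) + Φ(v,U,U)`
  have h6 : ∑ k : ↥S, (inner ℂ (symB S U v k) (curlVec (k : Fin 3 → ℤ) (U k))).re =
      helForm S U v U + helForm S v U U := by
    simp only [helForm, symB, Pi.add_apply, inner_add_left, Complex.add_re, Finset.sum_add_distrib]
  rw [h6]; linarith

/-- `U` itself is in the kernel of the linearisation at a cone point: `L_U U = 2 Q_S(U,U) = 0`. [folklore] -/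
theorem symB_self_eq_zero {U : ↥S → (EuclideanSpace ℂ (Fin 3))} (hcone : projB S U U = 0) : symB S U U = 0 := by
  simp [symB, hcone]

end Cone


end Summit.AnomalousDissipation.AnomalousDissipation.Theorems.GenericRunawayStokesScaling.Negative
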